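import Literature.NumberTheory.EllipticCurves.TwoDescentLocalOdd
import HarnessLib

/-!
# BirchSwinnertonDyer — rank ≥ 2 observatory: KERNEL-2DESC-Z2, bit calculus at a split odd prime

HONEST FRAMING: per-curve certified theorems and census instruments; no claim on BSD in rank ≥ 2.

Generic layer of the KERNEL-2DESC-Z2 instrument (design `b2b-bsdr2-cert-3/KERNEL-TRANSPORT.md`
§ KERNEL-2DESC-Z2; `code/b2b-bsdr2-cert-3/kernel-2desc-z2/README-Z2.md` §§ Feasibility, Design note).
At a degree-one prime `𝔩 = (π)` of `R = 𝓞 K` over an odd rational prime `ℓ = π·π'` (`π ∤ π'`), with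
residue map `res : R →+* ℤ/ℓ` of kernel `(π)`, the class of `α ∈ R ∖ 0` in `K_𝔩ˣ/K_𝔩ˣ²` is the pair
(parity of `k`, quadratic character of `c`) of any PRESENTATION `α = π^k·β`, `res β = c ≠ 0`
This file is the calculus of presentations — existence (`exists_pres`, `WfDvdMonoid`),
uniqueness (`pres_unique`), products, rational integers (`pres_intCast`: the `π'`-correction),
squares (`bits_eq_of_mul_eq_sq`) — and the POINT LEMMA of the `μ_θ`-descent (the conjugate trick): for a
rational point in integral form `m² = n(n² + A n e + B e²)`, `α = n − eθ`, either `res α ≠ 0` and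
`α` presents itself with `k = 0` (`pres_point_shallow`), or `res α = 0` and the bits of `α` are those
of `n` shifted by the character of `A + 2t₀` (`pres_point_deep`), because the conjugate
`n − eθ̄ = n + eA + eθ` is shallow and `α·ᾱ·n = m²`. No `ℓ`-adic numbers, no Hensel lifting.

Sorry-free; axioms `propext`, `Classical.choice`, `Quot.sound`. [folklore];
[cite: Cassels1991LecturesEllipticCurves, §15].
-/

-- single-conjunct summit: `Summit.BirchSwinnertonDyer.BirchSwinnertonDyer.…` repeats the name by design
set_option linter.dupNamespace false

noncomputable section

open scoped Classical

namespace Summit.BirchSwinnertonDyer.BirchSwinnertonDyer.Rank2Observatory.TwoDescZ2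

/-! ## The quadratic-character bit of a residue -/

section qrOf

variable {ℓ : ℕ} [Fact ℓ.Prime]

/-- The bit of a residue: `1` iff it is a non-square (for nonzero residues). Same shape as the tree's
`TwoDescentLocal.qrBit`, so `qrOf (TwoDescentLocal.res ℓ a) = TwoDescentLocal.qrBit ℓ a` by `rfl`.
[folklore] -/
def qrOf (c : ZMod ℓ) : ZMod 2 := if quadraticChar (ZMod ℓ) c = -1 then 1 else 0

/-- `qrOf` agrees with the tree's `TwoDescentLocal.qrBit` on residues of rationals (definitional). [folklore] -/
theorem qrOf_res (a : ℚ) :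
    qrOf (Literature.NumberTheory.EllipticCurves.TwoDescentLocal.res ℓ a) =
      Literature.NumberTheory.EllipticCurves.TwoDescentLocal.qrBit ℓ a := rfl

/-- `qrOf c = 0` iff `c` is a square. [folklore] -/
theorem qrOf_eq_zero_iff (c : ZMod ℓ) : qrOf c = 0 ↔ IsSquare c := by
  rw [qrOf]
  constructor
  · intro h
    by_contra hns
    rw [if_pos ((quadraticChar_neg_one_iff_not_isSquare).mpr hns)] at h
    exact one_ne_zero h
  · intro hsq
    rw [if_neg]
    rw [quadraticChar_neg_one_iff_not_isSquare, not_not]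
    exact hsq

/-- `qrOf` is additive on products of nonzero residues. [folklore] -/
theorem qrOf_mul {c c' : ZMod ℓ} (hc : c ≠ 0) (hc' : c' ≠ 0) :
    qrOf (c * c') = qrOf c + qrOf c' := by
  simp only [qrOf, map_mul]
  rcases quadraticChar_dichotomy hc with h1 | h1
  · rcases quadraticChar_dichotomy hc' with h2 | h2
    · simp [h1, h2]
    · simp [h1, h2]
  · rcases quadraticChar_dichotomy hc' with h2 | h2
    · simp [h1, h2]
    · simp only [h1, h2, mul_neg, mul_one, neg_neg, if_true]
      decide

/-- Squares have bit `0`. [folklore] -/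
theorem qrOf_sq (c : ZMod ℓ) : qrOf (c ^ 2) = 0 :=
  (qrOf_eq_zero_iff _).mpr ⟨c, sq c⟩

/-- Powers: `qrOf (c ^ v) = v • qrOf c`. [folklore] -/
theorem qrOf_pow {c : ZMod ℓ} (hc : c ≠ 0) (v : ℕ) : qrOf (c ^ v) = (v : ZMod 2) * qrOf c := by
  induction v with
  | zero => simp [qrOf]
  | succ v ih => rw [pow_succ, qrOf_mul (pow_ne_zero _ hc) hc, ih]; push_cast; ring

end qrOf

/-! ## Split-prime data and presentations -/

variable {R : Type*} [CommRing R] {ℓ : ℕ} [Fact ℓ.Prime]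

/-- **A degree-one prime of `R` over the odd prime `ℓ`**, by certificate: `ℓ = π·π'`, a residue map
`res : R → ℤ/ℓ` killing `π` but not `π'`, whose kernel consists of multiples of `π`. A PRESENTATION
of `α ≠ 0` is `α = π^k·β` with `res β ≠ 0`; the class of `α` in `K_𝔩ˣ/K_𝔩ˣ²` is `(k mod 2, qrOf (res β))`.
[folklore] -/
structure SplitPrime (R : Type*) [CommRing R] (ℓ : ℕ) where
  /-- generator of the prime `𝔩` -/
  π : R
  /-- the cofactor `ℓ / π` -/
  π' : R
  /-- the residue map `R → R/𝔩 = ℤ/ℓ` -/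
  res : R →+* ZMod ℓ
  hℓ : (ℓ : R) = π * π'
  hπ : res π = 0
  hπ' : res π' ≠ 0
  hker : ∀ β : R, res β = 0 → π ∣ β

variable (d : SplitPrime R ℓ)

/-- Multiples of `π` have residue `0`. [folklore] -/
theorem SplitPrime.res_eq_zero_of_dvd {β : R} (h : d.π ∣ β) : d.res β = 0 := by
  obtain ⟨γ, rfl⟩ := h
  rw [map_mul, d.hπ, zero_mul]

variable {d}

/-- **Existence** of a presentation of every nonzero element. [folklore] -/
theorem exists_pres [WfDvdMonoid R] {α : R} (hα : α ≠ 0) :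
    ∃ (k : ℕ) (β : R), α = d.π ^ k * β ∧ d.res β ≠ 0 := by
  -- `π` is not a unit: its residue is `0`
  obtain ⟨k, β, hndvd, rfl⟩ := WfDvdMonoid.max_power_factor' hα fun hu => (hu.map d.res).ne_zero d.hπ
  exact ⟨k, β, rfl, fun h => hndvd (d.hker β h)⟩

/-- An element with a presentation `α = π ^ k * β`, `res β ≠ 0`, is nonzero. [folklore] -/
theorem ne_zero_of_pres [CharZero R] [IsDomain R] {α β : R} {k : ℕ} (hα : α = d.π ^ k * β)
    (hβ : d.res β ≠ 0) : α ≠ 0 := by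
  rw [hα]
  -- `π ≠ 0` since `ℓ = π·π' ≠ 0` in characteristic `0`
  refine mul_ne_zero (pow_ne_zero _ (fun h0 => (Fact.out : ℓ.Prime).ne_zero (by exact_mod_cast (show (ℓ : R) = 0 by rw [d.hℓ, h0, zero_mul])))) ?_
  rintro rfl
  exact hβ (map_zero _)

/-- **Uniqueness** of the presentation. [folklore] -/
theorem pres_unique [CharZero R] [IsDomain R] {α β β' : R} {k k' : ℕ} (hα : α = d.π ^ k * β)
    (hβ : d.res β ≠ 0) (hα' : α = d.π ^ k' * β') (hβ' : d.res β' ≠ 0) : k = k' ∧ β = β' := by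
  suffices key : ∀ {β β' : R} {k k' : ℕ}, α = d.π ^ k * β → d.res β ≠ 0 → α = d.π ^ k' * β' →
      d.res β' ≠ 0 → k ≤ k' → k = k' ∧ β = β' by
    rcases le_total k k' with hle | hle
    · exact key hα hβ hα' hβ' hle
    · obtain ⟨h1, h2⟩ := key hα' hβ' hα hβ hle
      exact ⟨h1.symm, h2.symm⟩
  intro β β' k k' hα hβ hα' hβ' hle
  obtain ⟨j, rfl⟩ := Nat.exists_eq_add_of_le hle
  have hββ' : β = d.π ^ j * β' := by
    have h1 : d.π ^ k * β = d.π ^ k * (d.π ^ j * β') := by rw [← mul_assoc, ← pow_add, ← hα', hα]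
    exact mul_left_cancel₀ (pow_ne_zero _
      (fun h0 => (Fact.out : ℓ.Prime).ne_zero (by exact_mod_cast (show (ℓ : R) = 0 by rw [d.hℓ, h0, zero_mul])))) h1
  rcases Nat.eq_zero_or_pos j with hj | hj
  · subst hj
    rw [pow_zero, one_mul] at hββ'
    exact ⟨by simp, hββ'⟩
  · exfalso
    apply hβ
    rw [hββ']
    exact d.res_eq_zero_of_dvd (dvd_mul_of_dvd_left (dvd_pow_self _ hj.ne') _)

/-- Nonzero residues are closed under multiplication. [folklore] -/
theorem res_mul_ne_zero {β β' : R} (hβ : d.res β ≠ 0) (hβ' : d.res β' ≠ 0) :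
    d.res (β * β') ≠ 0 := by
  rw [map_mul]; exact mul_ne_zero hβ hβ'

/-- **Rational integers**: `r = ℓ^v·r₀` with `ℓ ∤ r₀` presents as `π^v · (π'^v r₀)`, with residue
`res(π')^v · r₀ ≠ 0` (the `π'`-correction of the rational `qrBit`). [folklore] -/
theorem pres_intCast {r r₀ : ℤ} {v : ℕ} (hr : r = (ℓ : ℤ) ^ v * r₀) (h0 : ¬ (ℓ : ℤ) ∣ r₀) :
    (r : R) = d.π ^ v * (d.π' ^ v * (r₀ : R)) ∧
      d.res (d.π' ^ v * (r₀ : R)) = d.res d.π' ^ v * (r₀ : ZMod ℓ) ∧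
        d.res d.π' ^ v * (r₀ : ZMod ℓ) ≠ 0 := by
  have hr0 : (r₀ : ZMod ℓ) ≠ 0 := fun h => h0 ((ZMod.intCast_zmod_eq_zero_iff_dvd r₀ ℓ).mp h)
  refine ⟨?_, by rw [map_mul, map_pow, map_intCast], mul_ne_zero (pow_ne_zero _ d.hπ') hr0⟩
  rw [hr]
  push_cast
  rw [d.hℓ, mul_pow]
  ring

/-- **Bits along a square relation**: if `α·z = γ²` then the presentations of `α` and `z` have the
same parity and the same character bit (how a realised pair `(T, U)` inherits the bits of `x − θ`).
[folklore] -/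
theorem bits_eq_of_mul_eq_sq [CharZero R] [IsDomain R] [WfDvdMonoid R] {α z γ βα βz : R}
    {kα kz : ℕ} (hα : α = d.π ^ kα * βα) (hβα : d.res βα ≠ 0) (hz : z = d.π ^ kz * βz)
    (hβz : d.res βz ≠ 0) (h : α * z = γ ^ 2) :
    (kα : ZMod 2) = kz ∧ qrOf (d.res βα) = qrOf (d.res βz) := by
  have hγ0 : γ ≠ 0 := by
    intro h0
    rw [h0, zero_pow two_ne_zero] at h
    rcases mul_eq_zero.mp h with h1 | h1
    · exact ne_zero_of_pres hα hβα h1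
    · exact ne_zero_of_pres hz hβz h1
  obtain ⟨kγ, βγ, hγ, hβγ⟩ := exists_pres (d := d) hγ0
  have h1 : α * z = d.π ^ (kα + kz) * (βα * βz) := by rw [hα, hz, pow_add]; ring
  have h2 : γ ^ 2 = d.π ^ (kγ + kγ) * (βγ * βγ) := by rw [hγ, pow_add]; ring
  rw [h] at h1
  obtain ⟨hk, hb⟩ := pres_unique h1 (res_mul_ne_zero hβα hβz) h2 (res_mul_ne_zero hβγ hβγ)
  have hb' : d.res βα * d.res βz = d.res βγ ^ 2 := by rw [← map_mul, hb, map_mul, sq]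
  constructor
  · have h3 : ((kα + kz : ℕ) : ZMod 2) = ((kγ + kγ : ℕ) : ZMod 2) := by rw [hk]
    push_cast at h3
    rw [← two_mul, show (2 : ZMod 2) = 0 from rfl, zero_mul] at h3
    have h4 : (kα : ZMod 2) = -kz := eq_neg_of_add_eq_zero_left h3
    rw [h4, ZMod.neg_eq_self_mod_two]
  · have h3 : qrOf (d.res βα * d.res βz) = qrOf (d.res βγ ^ 2) := by rw [hb']
    rw [qrOf_mul hβα hβz, qrOf_sq] at h3
    have h4 : qrOf (d.res βα) = -qrOf (d.res βz) := eq_neg_of_add_eq_zero_left h3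
    rw [h4, ZMod.neg_eq_self_mod_two]

/-! ## The class map `bitsAt` -/

/-- **The class of `α ≠ 0` at the split prime `d`**: `(k mod 2, qrOf (res β))` for any presentation
`α = π^k·β`, `res β ≠ 0` (well defined by `pres_unique`); `0 ↦ 0` by convention. This is the
coordinate of `α` in `K_𝔩ˣ/K_𝔩ˣ² ≅ (ℤ/2)²` used by the row functionals. [folklore] -/
noncomputable def bitsAt [WfDvdMonoid R] (d : SplitPrime R ℓ) (α : R) : ZMod 2 × ZMod 2 :=
  if hα : α = 0 then 0 else
    (((Classical.choose (exists_pres (d := d) hα) : ℕ) : ZMod 2),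
      qrOf (d.res (Classical.choose (Classical.choose_spec (exists_pres (d := d) hα)))))

/-- `bitsAt d 0 = 0` (the junk value at `0`). [folklore] -/
theorem bitsAt_zero [WfDvdMonoid R] : bitsAt d 0 = 0 := by
  rw [bitsAt, dif_pos rfl]

/-- `bitsAt` is computed by ANY presentation. [folklore] -/
theorem bitsAt_eq [CharZero R] [IsDomain R] [WfDvdMonoid R] {α β : R} {k : ℕ}
    (hα : α = d.π ^ k * β) (hβ : d.res β ≠ 0) :
    bitsAt d α = ((k : ZMod 2), qrOf (d.res β)) := by
  have hα0 : α ≠ 0 := ne_zero_of_pres hα hβ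
  rw [bitsAt, dif_neg hα0]
  obtain ⟨h1, h2⟩ := pres_unique
    (Classical.choose_spec (Classical.choose_spec (exists_pres (d := d) hα0))).1
    (Classical.choose_spec (Classical.choose_spec (exists_pres (d := d) hα0))).2 hα hβ
  rw [h2, h1]

/-- `bitsAt` is additive on products of non-zero elements. [folklore] -/
theorem bitsAt_mul [CharZero R] [IsDomain R] [WfDvdMonoid R] {α α' : R} (hα : α ≠ 0)
    (hα' : α' ≠ 0) : bitsAt d (α * α') = bitsAt d α + bitsAt d α' := by
  obtain ⟨k, β, h1, h2⟩ := exists_pres (d := d) hα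
  obtain ⟨k', β', h1', h2'⟩ := exists_pres (d := d) hα'
  have h11 : α * α' = d.π ^ (k + k') * (β * β') := by rw [h1, h1', pow_add]; ring
  rw [bitsAt_eq h11 (res_mul_ne_zero h2 h2'), bitsAt_eq h1 h2, bitsAt_eq h1' h2',
    map_mul, qrOf_mul h2 h2']
  simp

/-- Squares have trivial class. [folklore] -/
theorem bitsAt_sq [CharZero R] [IsDomain R] [WfDvdMonoid R] {γ : R} (hγ : γ ≠ 0) :
    bitsAt d (γ ^ 2) = 0 := by
  -- `(ℤ/2)²` is `2`-torsion (the tree's `…KummerQuartic.add_self_eq_zero`; inlined, not re-declared)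
  have h2 : ∀ b : ZMod 2 × ZMod 2, b + b = 0 := by decide
  rw [sq, bitsAt_mul hγ hγ, h2]

/-- **Classes along a square relation**: `α · w = γ²` (all non-zero) gives `bitsAt α = bitsAt w` —
how a realised pair of the cover set inherits the class of `x − θ`. [folklore] -/
theorem bitsAt_eq_of_mul_eq_sq [CharZero R] [IsDomain R] [WfDvdMonoid R] {α w γ : R} (hα : α ≠ 0)
    (hw : w ≠ 0) (h : α * w = γ ^ 2) : bitsAt d α = bitsAt d w := by
  have hγ : γ ≠ 0 := by
    rintro rfl
    rw [zero_pow two_ne_zero] at h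
    rcases mul_eq_zero.mp h with h1 | h1
    · exact hα h1
    · exact hw h1
  have h1 : bitsAt d α + bitsAt d w = 0 := by rw [← bitsAt_mul hα hw, h, bitsAt_sq hγ]
  have h2 : bitsAt d α = -bitsAt d w := eq_neg_of_add_eq_zero_left h1
  have h3 : ∀ b : ZMod 2 × ZMod 2, b + b = 0 := by decide
  rw [h2, neg_eq_iff_add_eq_zero, h3]

/-- **The three-term relation** of the descent: `n · α · ᾱ = m²` (all non-zero) gives
`bitsAt n + bitsAt α + bitsAt ᾱ = 0`. [folklore] -/
theorem bitsAt_add_add_eq_zero [CharZero R] [IsDomain R] [WfDvdMonoid R] {z α α' γ : R}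
    (hz : z ≠ 0) (hα : α ≠ 0) (hα' : α' ≠ 0) (h : z * α * α' = γ ^ 2) :
    bitsAt d z + bitsAt d α + bitsAt d α' = 0 := by
  have hγ : γ ≠ 0 := by
    rintro rfl
    rw [zero_pow two_ne_zero] at h
    rcases mul_eq_zero.mp h with h1 | h1
    · rcases mul_eq_zero.mp h1 with h2 | h2
      · exact hz h2
      · exact hα h2
    · exact hα' h1
  rw [← bitsAt_mul hz hα, ← bitsAt_mul (mul_ne_zero hz hα) hα', h, bitsAt_sq hγ]

/-- Class of a rational integer `r = ℓ^v r₀`, `ℓ ∤ r₀`: `(v, v·qrOf(res π') + qrBit_ℓ(r₀))`.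
[folklore] -/
theorem bitsAt_intCast [CharZero R] [IsDomain R] [WfDvdMonoid R] {r r₀ : ℤ} {v : ℕ}
    (hr : r = (ℓ : ℤ) ^ v * r₀) (h0 : ¬ (ℓ : ℤ) ∣ r₀) :
    bitsAt d (r : R) = ((v : ZMod 2), qrOf (d.res d.π' ^ v * (r₀ : ZMod ℓ))) := by
  obtain ⟨h1, h2, h3⟩ := pres_intCast (d := d) (R := R) hr h0
  rw [bitsAt_eq h1 (by rw [h2]; exact h3), h2]

/-! ## The point lemma of the `μ_θ` descent at a split odd prime -/

variable {θ : R} {A B : ℤ} {t₀ : ZMod ℓ}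

/-- The conjugate identity `(n − eθ)(n + eA + eθ) = n² + A n e + B e²` for `θ² + Aθ + B = 0`.
[folklore] -/
theorem mul_conj_eq_normForm (hq : θ ^ 2 + (A : R) * θ + (B : R) = 0) (n e : ℤ) :
    ((n : R) - (e : R) * θ) * ((n : R) + (e : R) * (A : R) + (e : R) * θ) =
      ((n ^ 2 + A * n * e + B * e ^ 2 : ℤ) : R) := by
  push_cast
  linear_combination (-(e : R) ^ 2) * hq

/-- Residue of `n − eθ`. [folklore] -/
theorem res_point (ht : d.res θ = t₀) (n e : ℤ) :
    d.res ((n : R) - (e : R) * θ) = (n : ZMod ℓ) - (e : ZMod ℓ) * t₀ := by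
  rw [map_sub, map_mul, map_intCast, map_intCast, ht]

/-- **Point lemma, shallow case**: if `n − e·t₀ ≠ 0 (mod ℓ)` then `n − eθ = π⁰·(n − eθ)` is its own
presentation, with residue `n − e t₀`. [folklore] -/
theorem pres_point_shallow (ht : d.res θ = t₀) {n e : ℤ}
    (hA : (n : ZMod ℓ) - (e : ZMod ℓ) * t₀ ≠ 0) :
    (n : R) - (e : R) * θ = d.π ^ 0 * ((n : R) - (e : R) * θ) ∧
      d.res ((n : R) - (e : R) * θ) ≠ 0 := by
  refine ⟨by rw [pow_zero, one_mul], ?_⟩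
  rw [res_point ht]; exact hA

/-- **Point lemma, deep case** (the conjugate trick). Integral form of a rational point:
`m² = n(n² + A n e + B e²)`, `e = d₀²`, `α = n − eθ ≠ 0`, and a presentation `n = π^k·βn`. If
`n − e t₀ = 0 (mod ℓ)` while `ℓ ∤ e` and `t₀` is a simple root (`A + 2t₀ ≠ 0 mod ℓ`), then `α` has a
presentation `π^k'·β'` with `k' ≡ k (mod 2)` and `qrOf (res β') = qrOf (res βn) + qrOf (A + 2t₀)`:
the conjugate `n + eA + eθ` has residue `e(A + 2t₀) ≠ 0` and `α · ᾱ · n = m²`.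
[cite: Cassels1991LecturesEllipticCurves, §15] -/
theorem pres_point_deep [CharZero R] [IsDomain R] [WfDvdMonoid R]
    (hq : θ ^ 2 + (A : R) * θ + (B : R) = 0) (ht : d.res θ = t₀) (hs : (A : ZMod ℓ) + 2 * t₀ ≠ 0)
    {n e m d₀ : ℤ} (he : e = d₀ ^ 2) (hE : m ^ 2 = n * (n ^ 2 + A * n * e + B * e ^ 2))
    (hB : (n : ZMod ℓ) - (e : ZMod ℓ) * t₀ = 0) (he0 : (e : ZMod ℓ) ≠ 0)
    (hα : (n : R) - (e : R) * θ ≠ 0) {k : ℕ} {βn : R} (hn : (n : R) = d.π ^ k * βn)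
    (hβn : d.res βn ≠ 0) :
    ∃ (k' : ℕ) (β' : R), (n : R) - (e : R) * θ = d.π ^ k' * β' ∧ d.res β' ≠ 0 ∧
      (k' : ZMod 2) = k ∧ qrOf (d.res β') = qrOf (d.res βn) + qrOf ((A : ZMod ℓ) + 2 * t₀) := by
  set α : R := (n : R) - (e : R) * θ with hαdef
  set αb : R := (n : R) + (e : R) * (A : R) + (e : R) * θ with hαbdef
  -- the conjugate is shallow with residue `e (A + 2 t₀)`
  have hresb : d.res αb = (e : ZMod ℓ) * ((A : ZMod ℓ) + 2 * t₀) := by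
    rw [hαbdef, map_add, map_add, map_mul, map_mul, map_intCast, map_intCast, map_intCast, ht]
    linear_combination hB
  have hb0 : d.res αb ≠ 0 := by rw [hresb]; exact mul_ne_zero he0 hs
  have hpb : αb = d.π ^ 0 * αb := by rw [pow_zero, one_mul]
  obtain ⟨kα, βα, hpα, hβα⟩ := exists_pres (d := d) hα
  -- `(α · αb) · n = m²`
  have hprod : α * αb * (n : R) = ((m : R)) ^ 2 := by
    have h1 : α * αb = ((n ^ 2 + A * n * e + B * e ^ 2 : ℤ) : R) := mul_conj_eq_normForm hq n e
    rw [h1, ← Int.cast_mul, ← Int.cast_pow, hE]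
    push_cast
    ring
  have hpαb : α * αb = d.π ^ (kα + 0) * (βα * αb) := by rw [hpα, add_zero]; ring
  obtain ⟨hk, hc⟩ := bits_eq_of_mul_eq_sq hpαb (res_mul_ne_zero hβα hb0) hn hβn hprod
  refine ⟨kα, βα, hpα, hβα, ?_, ?_⟩
  · simpa using hk
  · rw [map_mul, qrOf_mul hβα hb0, hresb, qrOf_mul he0 hs] at hc
    have hesq : qrOf (e : ZMod ℓ) = 0 := by
      rw [he]; push_cast; exact qrOf_sq _
    rw [hesq, zero_add] at hc
    have h4 : qrOf (d.res βα) = qrOf (d.res βn) - qrOf ((A : ZMod ℓ) + 2 * t₀) :=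
      eq_sub_of_add_eq hc
    rw [h4, sub_eq_add_neg, ZMod.neg_eq_self_mod_two]

end Summit.BirchSwinnertonDyer.BirchSwinnertonDyer.Rank2Observatory.TwoDescZ2

end
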